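import Summits.QuantumFields.BalabanUV.T4Continuum.Support.NE9Lemma1CurveSpecies
import Summits.QuantumFields.BalabanUV.T4Continuum.Support.NE9AnalyticClassMargProj

/-!
# NE9CurveSpeciesMargProj — crew row (w21)-MP: the MARGINAL-PROJECTION leaf (row MP, `hPinto`) DISCHARGED AT THE CURVE SPECIES
# `CurData` of the owner's LOCATED CORRECTION O-ne9p1g25-1 — the two END-M read-out faces of `NE9RemainderSpeciesMargProj`
# (p213217 §3/§4, ray datum) re-instantiated at `𝒯 := cpieceChannel Dc.toC` with S-sum, S5 AND MP discharged BY NAME (the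
# datum-generic faces of `NE9AnalyticClassMargProj` at `P := Dc.toC`), and the ray faces RECOVERED at `Dc := D.toCur`
# (cell `pub-balaban`, T4-DAG §2 node U3 / §6 NE9; NE9 formalisation swarm, unit `b2b-balaban-t4-ne9-formalise-leaf-04` gen 6 —
# crew row (w21)-MP of the owner g25's list, journal l.9603 / INTENT l.9736)

HONEST FRAMING (T4-DAG PAGE 1).  Rung (B)+1 of the FINITE-VOLUME T⁴ programme — NOT infinite volume, NOT a mass gap, NOT the
Clay problem.  NE9 (`T4OutputRate.NE9` ∧ `FadingMemory`) is a cell NEW ESTIMATE, NOT PRINTED, NOT discharged here; spine 0/9;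
0/18 skeleton leaves instantiated on Bałaban's objects (O-NE9-1).  HONEST DEPENDENCY (cell line, verbatim): continuum YM on T⁴
⇐ BetaPertH ∧ nine spine estimates (0/9 proved); BetaPertH ⇐ (D1) ∧ (D4) ∧ CAP+tail; G-an2-4 gates asym, D1 and NE2/3/4.
`FlowStep.BetaPertH`, (B), (B^μ) do not occur.  [I] = [Balaban1987RG1] (CMP **109**), [II] = [Balaban1988RG2Cluster]
(CMP **116**) are quoted for TYPES only (ABSOLUTE RULE: nothing printed in the audited series is asserted).

WHERE THIS SITS.  Lineage gen 5 (`NE9RemainderSpeciesMargProj`, p213217) closed the MP socket of the END-M read-out faces AT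
THE DISPLAYED SPECIES typed as `RemData` (contour DIRECTIONS; the old term expanded along RAYS `τ ↦ τ•A(t,s,σ)`).  The row
owner's LOCATED FINDING F-ne9p1g25-1 (journal l.9603; `NE9Lemma1CurveRemainder` p213669, `NE9Lemma1CurveSpecies` p213869): for
non-abelian `G` the σ-disc of [I] Lemma 4 (3.53)–(3.54) p. 280 is mapped to an analytic CURVE `σ ↦ U_j(□₀, exp iσB)|_X` through
the expansion point ((3.30) p. 276, (3.37) p. 277: minimizer composed with the group law, configuration-dependent gauge), a ray
only for abelian `G` — so the species is RE-TYPED as the curve datum `CurData` (slice CURVES `cur`, slice radii `ϱ`, binder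
structure `CurData.Admissible` of Lemma-4 TYPE, per-piece bound `pieceBoundOnG_cur` PROVED on the analytic class), the ray
species embedding by `RemData.toCur` with `RemData.toCur_toC : D.toCur.toC = D.toC` (`rfl`).  Lineage gen 6 first made the MP
discharge DATUM-GENERIC (`NE9AnalyticClassMargProj`: the faces for ANY class-relative piece form bounded on the analytic class);
THIS FILE is their instance at the curve datum — crew row (w21)-MP:
* §1 **`termSize_ne9_and_fadingMemory_cur_margProj_cpieceForm`** = p213217 §3 token-for-token with `D : RemData`/`D.toC`/`D.R`/
  `D.κ₁`/`KpOf D c_dir` ↦ `Dc : CurData`/`Dc.toC`/`Dc.R`/`Dc.κ₁`/`Dc.Kp c_dir`: `NE9AnalyticClassMargProj` §1 at `P := Dc.toC` with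
  `hP0 hloc hsrc hPieceAn hKp` := the owner's `pieceZero_cur`/`pieceLocal_cur`/`csrcScale_cur`/**`pieceBoundOnG_cur`**/`kp_nonneg`
  (p213869); MP := p213217 §2; S-sum/S5 by name; additivity on `Adm`/`MF` := the ONE displayed `PieceAdditiveOn (analyticClass
  Dc.R) Dc.toC` (crew row (w19), `pieceAdditiveOn_cur`) restricted; leaf A3 displayed as `hrespE`/`hrespA` at `Dc.toC` (crew
  row (w20)).
* §2 **`termSize_ne9_and_fadingMemory_cur_margProj`** = p213217 §4 token-for-token at the curve datum: `NE9AnalyticClassMargProj`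
  §2 at `P := Dc.toC` (END-M `…_compProj` by name with the four projection binders supplied — `ProjInto` := p213217 §2 —, i.e.
  the `…_margProj` twin of the owner's part-3 curve END face by END-M's own route); leaf A3 displayed as `hTcup`.
* §3 **THE RAY SUB-CASE RECOVERED**: at `Dc := D.toCur` the letters agree definitionally (`toCur_toC`, `toCur_Kp`, `rfl`), and
  p213217 §3's statement for `D : RemData`, `hD : D.Admissible ℓ c_dir d₀` follows from §1 through `RemData.Admissible.toCur`
  under the (displayed, harmless) strict positivity of the direction bounds — the kernel check that the curve face GENERALISES
  the landed ray face (an `example`; no new name).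
DISPLAYED on §1/§2 (honest list): O1-type data (`CurData` — Bałaban's pieces ARE `CurData.toC` of his (1.23) data, the curve at
(k, □₀, Y₀, X; t, s, σ) being σ′ ↦ the chart of `U_j(□₀, exp i(B + σ′B))|_X` —, the carriers, `r`, `A`, `S`, `Ψ`, `act`, `ρ`,
…), the species' `CurData.Admissible` (Lemma-4 TYPE: slice curves analytic on `|σ′| < ϱ` and INSIDE the analyticity ball ON THE
CONTOURS, ϱ > 1, gain ϱ⁻¹ ≤ c_dir·ℓ, radii, G1, source discipline — [I] (3.53)–(3.54) p. 280; [II] (1.25) p. 7) + `LevelCountsG`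
((1.26)–(1.28)), `Adm ⊆ analyticClass Dc.R`, AW (`DirSize A κ aA`, `A ∈ analyticClass`, `hAmul`), RO (`hrA hr0 hrs` +
ray-homogeneity `hcoef` + NORMALISATION `hnorm` — O1's number), the S-closure `hS`, (w19), in §1 `hrespE`/`hrespA`, in §2
`hTcup`, and END-M's A1/A2/R/G/N binders VERBATIM.  DISGUISE TEST: one input family, one read-out, one marginal direction, set
algebra of classes + the END applied by name — no history comparison is proved here; not NE9.

References (TYPES only): [Balaban1987RG1] T. Bałaban, *Renormalization group approach to lattice gauge field theories. I*,
Commun. Math. Phys. **109** (1987) 249–301 — (0.28)–(0.30) p. 258, (1.3) p. 260, (1.11)–(1.14) p. 262, (1.18) p. 263,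
(1.20)–(1.22) p. 264, (3.30) p. 276, (3.36)–(3.37) p. 277, Lemma 4 (3.53)–(3.54) p. 280; [Balaban1988RG2Cluster] T. Bałaban,
*… II. Cluster expansions*, Commun. Math. Phys. **116** (1988) 1–22 — (1.23)–(1.29) pp. 7–8, (1.33)–(1.36) p. 9.  Summits-side
NEW work (LEAN PLACEMENT RULE); imports `NE9Lemma1CurveSpecies` (owner g25 part 2, p213869) + `NE9AnalyticClassMargProj` (this
lineage, gen 6; hence p213217/p213009/p212850/p212551/p210502) BY NAME; modifies nothing; 0 sorry; 0 `def`.  Value = the MP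
binder removed from the displayed list of the CURVE species' END-M read-out faces (modulo O1's normalisation number and the
read-out's ray-homogeneity), NOT summit progress.
-/

noncomputable section

namespace Summit.QuantumFields.BalabanUV.T4Continuum.NE9CurveSpeciesMargProj

open scoped BigOperators
open Metric Set
open Literature.MathematicalPhysics.QuantumFieldTheory.Balaban1983to89
open Literature.MathematicalPhysics.QuantumFieldTheory.Balaban1983to89.T4OutputRate
open Literature.MathematicalPhysics.QuantumFieldTheory.Balaban1983to89.T4HistoryLipschitzRecursion
open Literature.MathematicalPhysics.QuantumFieldTheory.Balaban1983to89.T4HistoryLipschitzOuter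
open Literature.MathematicalPhysics.QuantumFieldTheory.Balaban1983to89.T4HistoryLipschitzActivity
open Literature.MathematicalPhysics.QuantumFieldTheory.Balaban1983to89.T4HistoryLipschitzActivity (ClusterGeom)
open Literature.MathematicalPhysics.QuantumFieldTheory.Balaban1983to89.T4HistoryLipschitzSegment
open Summit.QuantumFields.BalabanUV.T4Continuum.NE9Lemma1Counting
open Summit.QuantumFields.BalabanUV.T4Continuum.NE9Lemma1Gain
open Summit.QuantumFields.BalabanUV.T4Continuum.NE9Lemma1PieceClass
open Summit.QuantumFields.BalabanUV.T4Continuum.NE9Lemma1RemainderSpecies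
open Summit.QuantumFields.BalabanUV.T4Continuum.NE9Lemma1CurveSpecies
open Summit.QuantumFields.BalabanUV.T4Continuum.NE9ComplexEncoding (doubleCarriers)
open Summit.QuantumFields.BalabanUV.T4Continuum.NE9LastCouplingBridge
open Summit.QuantumFields.BalabanUV.T4Continuum.NE9BridgeSizeInduction
open Summit.QuantumFields.BalabanUV.T4Continuum.NE9MarginalProjection
open Summit.QuantumFields.BalabanUV.T4Continuum.NE9MarginalProjectionEnd
open Summit.QuantumFields.BalabanUV.T4Continuum.NE9AnalyticClassMargProj

variable {C₀ : Carriers} {E : Type} [NormedAddCommGroup E] [NormedSpace ℂ E] {ι α β γ δ : Type} [DecidableEq δ]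
variable (G : ClusterGeom (doubleCarriers C₀)) {Pot : Type*} [NormedAddCommGroup Pot] [NormedSpace ℂ Pot]

/-! ## §1 The END-M read-out face at the CURVE species, MP / S-sum / S5 discharged -/

/-- **NE9 ∧ FADING MEMORY ∧ TERM SIZE ON THE v1.3 DICTIONARY AT THE CURVE SPECIES — rows MP, S-sum, S5 DISCHARGED (kernel
end-to-end; crew row (w21)-MP, the twin of p213217 §3).**  `NE9AnalyticClassMargProj` §1 (p212551's END-M face at form level with
MP := p213217 §2) at `P := Dc.toC` — the curve species of the owner's located correction O-ne9p1g25-1 (`NE9Lemma1CurveSpecies`):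
`PieceZero`/`PieceLocal`/`CSrcScale` := `pieceZero_cur`/`pieceLocal_cur`/`csrcScale_cur`; S5's per-piece bound ON THE ANALYTIC
CLASS := the owner's **`pieceBoundOnG_cur`** (PROVED: (I.3.54) = Cauchy in σ along the slice curves ⊕ [II] (1.24)–(1.25)),
`Kp := Dc.Kp c_dir`, `gain := ℓ⁵`.  DISPLAYED: the species' `CurData.Admissible` (Lemma 4 (3.53) TYPE: slice curves analytic and
inside the analyticity ball on the contours, ϱ > 1, gain ϱ⁻¹ ≤ c_dir·ℓ; radii; G1) and `LevelCountsG` ((1.26)–(1.28)); `Adm ⊆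
analyticClass Dc.R`; AW (`DirSize`, `A ∈ analyticClass`, `hAmul`); RO (`hrA hr0 hrs`, ray-homogeneity `hcoef`, normalisation
`hnorm`); the S-closure `hS`; additivity `PieceAdditiveOn (analyticClass Dc.R) Dc.toC` (crew row (w19)); the species' per-piece
coupling responses `hrespE`/`hrespA` (leaf A3, crew row (w20)); and every other END-M binder VERBATIM.  Conclusion = END-M's with
`τbar := c_Q`, `qTbar := (qc + cr·Nbar·qcA)·c_Q·(1−ω)⁻¹`.  Nothing of [I]–[II] asserted; NE9 NOT PROVED; 0/9 unchanged.
[cite: Balaban1987RG1, (0.28)-(0.30) p.258, (1.3) p.260, (1.18) p.263, (1.20)-(1.22) p.264, (3.53)-(3.54) p.280; Balaban1988RG2Cluster, (1.23)-(1.29) pp.7-8, (1.33)-(1.36) p.9] -/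
theorem termSize_ne9_and_fadingMemory_cur_margProj_cpieceForm
    {Dc : CurData C₀ E ι α β γ δ} {ℓg : ℕ → ℕ → ℝ} {cdir d0 : ℝ}
    {Ef : Functional (doubleCarriers C₀) E} {W : Set (ℕ → ℝ)} {Adm S : Set (E → (doubleCarriers C₀).Dom → ℝ)}
    {r : ℕ → (E → (doubleCarriers C₀).Dom → ℝ) → ℝ} {A : E → (doubleCarriers C₀).Dom → ℝ}
    {Ψ : ℕ → ℝ → (ι → ℝ) → E → (doubleCarriers C₀).Dom → ℝ} {act : ℕ → ℝ → E → Pot → G.P → ℂ} {𝒜 : ℕ → Set Pot}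
    {n : ℕ → ℝ → E → G.P → ℝ} {lip clip : ℕ → ℝ} {a d : G.P → ℝ} {δv : (doubleCarriers C₀).Dom → ℝ}
    {κ O1 cQ ω qc qcA Nbar B lipbar clipbar cr aA : ℝ} {p₀ N : ℕ → ℝ}
    (ρ : ℕ → (ι → ℝ) → Pot) (U₀ : E) (explZ : ℕ → E → (doubleCarriers C₀).Dom → ℝ) (h0 : ScaleZeroFree Ef W)
    (hAdm : AdmissibleTerms Ef W Adm) (hres : AdmRestrict Adm)
    -- the species' binders (printed TYPE + numerals) and the analyticity of the admissible terms
    (hD : Dc.Admissible ℓg cdir d0) (hℓg : ∀ k j, 0 ≤ ℓg k j)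
    (hL : LevelCountsG Dc.toC.frame κ Dc.κ₁ O1 cQ (fun k j => ℓg k j ^ 5) (agePow ω))
    (hAdmAn : Adm ⊆ analyticClass Dc.R)
    -- crew row (w19): additivity of the (1.23)-pieces in the old term along the slice curves, on the analytic class (displayed)
    (hA16 : PieceAdditiveOn (analyticClass Dc.R) Dc.toC)
    -- the read-out and the marginal direction (END-M's RO / AW binders, verbatim) …
    (hrA : ReadAdditive Adm r) (hr0 : ReadZero r) (hrs : ReadSize Adm r κ cr) (hA : DirSize A κ aA) (hcr : 0 ≤ cr)
    (haA : 0 ≤ aA)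
    -- … and what MP needs of them at the species: analyticity of `A`, its scale-wise multiples admissible (p212551's `hAmul`),
    -- ray-homogeneity and NORMALISATION of the read-out, the closure of the structural class `S` under the projection
    (hAan : A ∈ analyticClass Dc.R)
    (hAmul : ∀ c : ℕ → ℝ, (fun U X' => c ((doubleCarriers C₀).scale X') * A U X') ∈ Adm)
    (hcoef : ∀ (j : ℕ) (c : ℝ), r j (restrictScale j (c • A)) = c * r j (restrictScale j A))
    (hnorm : ∀ j : ℕ, r j (restrictScale j A) = 1 ∨ ∀ H ∈ Adm, r j (restrictScale j H) = 0)
    (hS : ∀ H ∈ Adm, margProj r A H ∈ S)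
    -- leaf A3 at the species (crew row (w20)): the per-piece coupling responses of the terms and of the multiples of `A`
    (hrespE : ∀ g ∈ W, ∀ g' ∈ W, ∀ (k : ℕ) (y : ι), ∀ a' ∈ Dc.toC.S0 k y, ∀ b ∈ Dc.toC.SY k y a', ∀ (j : ℕ),
      ∀ x ∈ Dc.toC.src k y a' j,
      |Dc.toC.piece k g y a' b x (Ef g) - Dc.toC.piece k g' y a' b x (Ef g)| ≤
        Dc.Kp cdir k y * qc * ℓg k j ^ 5 * Real.exp (-(κ * (doubleCarriers C₀).d x)) *
          Real.exp (-(1 / 8) * (Dc.κ₁ - 1) * Dc.toC.dY k y + (1 / 8) * Dc.κ₁ * d0 -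
            (1 / 2) * (Dc.κ₁ - 1) * Dc.toC.vol k y a' b) *
            |g k - g' k|)
    (hrespA : ∀ g ∈ W, ∀ g' ∈ W, ∀ (k : ℕ) (y : ι), ∀ a' ∈ Dc.toC.S0 k y, ∀ b ∈ Dc.toC.SY k y a', ∀ (j : ℕ),
      ∀ x ∈ Dc.toC.src k y a' j, ∀ c : ℕ → ℝ,
      |Dc.toC.piece k g y a' b x (fun U X => c ((doubleCarriers C₀).scale X) * A U X) -
          Dc.toC.piece k g' y a' b x (fun U X => c ((doubleCarriers C₀).scale X) * A U X)| ≤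
        |c ((doubleCarriers C₀).scale x)| * (Dc.Kp cdir k y * qcA * ℓg k j ^ 5 * Real.exp (-(κ * (doubleCarriers C₀).d x)) *
          Real.exp (-(1 / 8) * (Dc.κ₁ - 1) * Dc.toC.dY k y + (1 / 8) * Dc.κ₁ * d0 -
            (1 / 2) * (Dc.κ₁ - 1) * Dc.toC.vol k y a' b) *
            |g k - g' k|))
    (hqc : 0 ≤ qc) (hqcA : 0 ≤ qcA) (hO1 : 0 ≤ O1) (hcQ : 0 ≤ cQ) (hω0 : 0 ≤ ω) (hω1 : ω < 1) (hNb : ∀ j, N j ≤ Nbar)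
    -- END-M's remaining binders at `T := cpieceChannel Dc.toC ∘ margProj r A`, verbatim
    (hfac : Factorises Ef W (compProj (cpieceChannel Dc.toC) (margProj r A)) Ψ) (hclip0 : ∀ k, 0 ≤ clip k)
    (hCup : ∀ g ∈ W, ∀ g' ∈ W, ∀ (k : ℕ) (U : E) (X : (doubleCarriers C₀).Dom), (doubleCarriers C₀).scale X = k + 1 →
      ∀ Q ∈ 𝒜 k, ∀ γ' ∈ G.vol X,
      ‖act k (g k) U Q γ'‖ ≤ n k (g' k) U γ' ∧
        ‖act k (g k) U Q γ' - act k (g' k) U Q γ'‖ ≤ clip k * |g k - g' k| * n k (g' k) U γ')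
    (hreprV : ∀ (k : ℕ) (s : ℝ) (Q : ι → ℝ) (U : E) (X : (doubleCarriers C₀).Dom),
      Ψ k s Q U X = (G.newTerm act k s U X (ρ k Q)).re - (G.newTerm act k s U₀ X (ρ k Q)).re + explZ k U X)
    (hclipb : ∀ k, clip k ≤ clipbar)
    (hK : TwoPointKP G W act 𝒜 n lip a d) (hdec : G.DecayExtract δv d) (hpin : G.PinBudget a δv (fun _ => B) κ)
    (hρ : ∀ (k : ℕ) (Q Q' : ι → ℝ) (M : ℝ),
      (∀ y, |Q y - Q' y| ≤ weightOf Dc.toC.frame Dc.κ₁ d0 O1 (Dc.Kp cdir) k y * M) → ‖ρ k Q - ρ k Q'‖ ≤ M)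
    (hexplZ : ∀ (k : ℕ) (U : E) (X : (doubleCarriers C₀).Dom), (doubleCarriers C₀).scale X = k + 1 →
      |explZ k U X| ≤ Real.exp (-(κ * (doubleCarriers C₀).d X)) * p₀ k)
    (hbase : ∀ g ∈ W, ∀ (U : E) (X : (doubleCarriers C₀).Dom), (doubleCarriers C₀).scale X = 0 →
      |Ef g U X| ≤ Real.exp (-(κ * (doubleCarriers C₀).d X)) * N 0)
    (hNsucc : ∀ j, p₀ j + 2 * B ≤ N (j + 1)) (hNnn : ∀ j, 0 ≤ N j)
    (hbox : ∀ (k : ℕ) (Q : ι → ℝ),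
      (∀ y, |Q y| ≤ weightOf Dc.toC.frame Dc.κ₁ d0 O1 (Dc.Kp cdir) k y *
        sizeRadius (fun k j => (1 + cr * aA) * tauOfG cQ (agePow ω) k j) N k) → ρ k Q ∈ 𝒜 k)
    (hB : 0 ≤ B) (hlipb : ∀ k, lip k ≤ lipbar) (hpos : 0 < ω + 8 * lipbar * B * ((1 + cr * aA) * cQ)) :
    TermSize Ef W κ N ∧
      NE9 Ef W κ (prodModuli (8 * clipbar * B + 8 * lipbar * B * ((qc + cr * Nbar * qcA) * cQ * (1 - ω)⁻¹))
        fun _ => ω + 8 * lipbar * B * ((1 + cr * aA) * cQ)) ∧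
        FadingMemory ((8 * clipbar * B + 8 * lipbar * B * ((qc + cr * Nbar * qcA) * cQ * (1 - ω)⁻¹)) /
            (ω + 8 * lipbar * B * ((1 + cr * aA) * cQ)))
          (ω + 8 * lipbar * B * ((1 + cr * aA) * cQ))
          (prodModuli (8 * clipbar * B + 8 * lipbar * B * ((qc + cr * Nbar * qcA) * cQ * (1 - ω)⁻¹))
            fun _ => ω + 8 * lipbar * B * ((1 + cr * aA) * cQ)) :=
  termSize_ne9_and_fadingMemory_analytic_margProj_cpieceForm G Dc.toC ρ U₀ explZ h0 hAdm hres (pieceZero_cur Dc)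
    (pieceLocal_cur Dc) (csrcScale_cur hD) (pieceBoundOnG_cur hD κ) (kp_nonneg hD) (fun k j => pow_nonneg (hℓg k j) 5) hL
    hAdmAn hA16 hrA hr0 hrs hA hcr haA hAan hAmul hcoef hnorm hS hrespE hrespA hqc hqcA hO1 hcQ hω0 hω1 hNb hfac hclip0 hCup
    hreprV hclipb hK hdec hpin hρ hexplZ hbase hNsucc hNnn hbox hB hlipb hpos

/-! ## §2 The `…_margProj` face at the CURVE species, MP / S-sum / S5 discharged, A3 as `hTcup` -/

/-- **THE `…_margProj` FACE AT THE CURVE SPECIES — rows MP, S-sum, S5 DISCHARGED, A3 displayed as `hTcup` (kernel end-to-end;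
crew row (w21)-MP, the twin of p213217 §4).**  `NE9AnalyticClassMargProj` §2 (END-M `…_compProj` BY NAME at `P := margProj r A`
with `ProjAdditive`/`ProjScaleComm`/`ProjSize` from RO/AW and **`ProjInto` := p213217 §2**) at `P := Dc.toC`, `MF := {H | H ∈
analyticClass Dc.R ∧ H ∈ S ∧ ∀ j, r_j(H↾j) = 0}`, `c := cr·aA`: `ChannelStepSum` := `channelStepSum_cpiece` ∘ `pieceZero_cur`/
`pieceLocal_cur`/`csrcScale_cur`, `ChannelSizeAtStepNN` := `channelSizeAtStepNN_cpieceG` ∘ the owner's **`pieceBoundOnG_cur`**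
restricted to `MF`, `ChannelAdditive` from the displayed (w19) additivity, profile `profileG` (τ̄ = c_Q) — the `…_margProj` twin
of the owner's part-3 curve END face by END-M's own route.  DISPLAYED: as in §1 with `hrespE`/`hrespA` replaced by `hTcup`.
Conclusion LITERALLY END-M `…_margProj`'s with `τbar := c_Q`.  Nothing of [I]–[II] asserted; NE9 NOT PROVED; 0/9 unchanged.
[cite: Balaban1987RG1, (0.28)-(0.30) p.258, (1.3) p.260, (1.18) p.263, (1.20)-(1.22) p.264, (3.53)-(3.54) p.280; Balaban1988RG2Cluster, (1.23)-(1.29) pp.7-8, (1.33)-(1.36) p.9] -/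
theorem termSize_ne9_and_fadingMemory_cur_margProj
    {Dc : CurData C₀ E ι α β γ δ} {ℓg : ℕ → ℕ → ℝ} {cdir d0 O1 cQ : ℝ}
    {Ef : Functional (doubleCarriers C₀) E} {W : Set (ℕ → ℝ)} {Adm S : Set (E → (doubleCarriers C₀).Dom → ℝ)}
    {r : ℕ → (E → (doubleCarriers C₀).Dom → ℝ) → ℝ} {A : E → (doubleCarriers C₀).Dom → ℝ}
    {Ψ : ℕ → ℝ → (ι → ℝ) → E → (doubleCarriers C₀).Dom → ℝ} {act : ℕ → ℝ → E → Pot → G.P → ℂ} {𝒜 : ℕ → Set Pot}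
    {n : ℕ → ℝ → E → G.P → ℝ} {lip clip : ℕ → ℝ} {a d : G.P → ℝ} {δv : (doubleCarriers C₀).Dom → ℝ}
    {κ B lipbar clipbar qTbar ω cr aA : ℝ} {qT p₀ N : ℕ → ℝ}
    -- the species' binders (printed TYPE + numerals) and the analyticity of the admissible terms
    (hD : Dc.Admissible ℓg cdir d0) (hℓg : ∀ k j, 0 ≤ ℓg k j)
    (hL : LevelCountsG Dc.toC.frame κ Dc.κ₁ O1 cQ (fun k j => ℓg k j ^ 5) (agePow ω)) (hO1 : 0 ≤ O1) (hcQ : 0 ≤ cQ)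
    (hAdmAn : Adm ⊆ analyticClass Dc.R)
    -- crew row (w19): additivity of the (1.23)-pieces along the slice curves on the analytic class (displayed)
    (hA16 : PieceAdditiveOn (analyticClass Dc.R) Dc.toC)
    -- the face's binders, verbatim …
    (ρ : ℕ → (ι → ℝ) → Pot) (U₀ : E) (explZ : ℕ → E → (doubleCarriers C₀).Dom → ℝ) (h0 : ScaleZeroFree Ef W)
    (hAdm : AdmissibleTerms Ef W Adm) (hres : AdmRestrict Adm)
    -- … with END-M's RO / AW binders in place of the four projection binders …
    (hrA : ReadAdditive Adm r) (hr0 : ReadZero r) (hrs : ReadSize Adm r κ cr) (hA : DirSize A κ aA) (hcr : 0 ≤ cr)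
    (haA : 0 ≤ aA)
    -- … and what MP needs at the species (p213217 §2)
    (hAan : A ∈ analyticClass Dc.R)
    (hAmul : ∀ c : ℕ → ℝ, (fun U X' => c ((doubleCarriers C₀).scale X') * A U X') ∈ Adm)
    (hcoef : ∀ (j : ℕ) (c : ℝ), r j (restrictScale j (c • A)) = c * r j (restrictScale j A))
    (hnorm : ∀ j : ℕ, r j (restrictScale j A) = 1 ∨ ∀ H ∈ Adm, r j (restrictScale j H) = 0)
    (hS : ∀ H ∈ Adm, margProj r A H ∈ S)
    (hfac : Factorises Ef W (compProj (cpieceChannel Dc.toC) (margProj r A)) Ψ) (hclip0 : ∀ k, 0 ≤ clip k)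
    (hCup : ∀ g ∈ W, ∀ g' ∈ W, ∀ (k : ℕ) (U : E) (X : (doubleCarriers C₀).Dom), (doubleCarriers C₀).scale X = k + 1 →
      ∀ Q ∈ 𝒜 k, ∀ γ' ∈ G.vol X,
      ‖act k (g k) U Q γ'‖ ≤ n k (g' k) U γ' ∧
        ‖act k (g k) U Q γ' - act k (g' k) U Q γ'‖ ≤ clip k * |g k - g' k| * n k (g' k) U γ')
    (hqT0 : ∀ k, 0 ≤ qT k)
    (hTcup : ∀ g ∈ W, ∀ g' ∈ W, ∀ (k : ℕ) (y : ι),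
      |compProj (cpieceChannel Dc.toC) (margProj r A) k g (Ef g) y -
          compProj (cpieceChannel Dc.toC) (margProj r A) k g' (Ef g) y| ≤
        weightOf Dc.toC.frame Dc.κ₁ d0 O1 (Dc.Kp cdir) k y * (qT k * |g k - g' k|))
    (hreprV : ∀ (k : ℕ) (s : ℝ) (Q : ι → ℝ) (U : E) (X : (doubleCarriers C₀).Dom),
      Ψ k s Q U X = (G.newTerm act k s U X (ρ k Q)).re - (G.newTerm act k s U₀ X (ρ k Q)).re + explZ k U X)
    (hclipb : ∀ k, clip k ≤ clipbar) (hqTb : ∀ k, qT k ≤ qTbar)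
    (hK : TwoPointKP G W act 𝒜 n lip a d) (hdec : G.DecayExtract δv d) (hpin : G.PinBudget a δv (fun _ => B) κ)
    (hρ : ∀ (k : ℕ) (Q Q' : ι → ℝ) (M : ℝ),
      (∀ y, |Q y - Q' y| ≤ weightOf Dc.toC.frame Dc.κ₁ d0 O1 (Dc.Kp cdir) k y * M) → ‖ρ k Q - ρ k Q'‖ ≤ M)
    (hexplZ : ∀ (k : ℕ) (U : E) (X : (doubleCarriers C₀).Dom), (doubleCarriers C₀).scale X = k + 1 →
      |explZ k U X| ≤ Real.exp (-(κ * (doubleCarriers C₀).d X)) * p₀ k)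
    (hbase : ∀ g ∈ W, ∀ (U : E) (X : (doubleCarriers C₀).Dom), (doubleCarriers C₀).scale X = 0 →
      |Ef g U X| ≤ Real.exp (-(κ * (doubleCarriers C₀).d X)) * N 0)
    (hNsucc : ∀ j, p₀ j + 2 * B ≤ N (j + 1)) (hNnn : ∀ j, 0 ≤ N j)
    (hbox : ∀ (k : ℕ) (Q : ι → ℝ), (∀ y, |Q y| ≤ weightOf Dc.toC.frame Dc.κ₁ d0 O1 (Dc.Kp cdir) k y *
      sizeRadius (fun k j => (1 + cr * aA) * tauOfG cQ (agePow ω) k j) N k) → ρ k Q ∈ 𝒜 k)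
    (hB : 0 ≤ B) (hlipb : ∀ k, lip k ≤ lipbar) (hω : 0 ≤ ω)
    (hpos : 0 < ω + 8 * lipbar * B * ((1 + cr * aA) * cQ)) :
    TermSize Ef W κ N ∧
      NE9 Ef W κ (prodModuli (8 * clipbar * B + 8 * lipbar * B * qTbar)
        fun _ => ω + 8 * lipbar * B * ((1 + cr * aA) * cQ)) ∧
        FadingMemory ((8 * clipbar * B + 8 * lipbar * B * qTbar) / (ω + 8 * lipbar * B * ((1 + cr * aA) * cQ)))
          (ω + 8 * lipbar * B * ((1 + cr * aA) * cQ))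
          (prodModuli (8 * clipbar * B + 8 * lipbar * B * qTbar) fun _ => ω + 8 * lipbar * B * ((1 + cr * aA) * cQ)) :=
  termSize_ne9_and_fadingMemory_analytic_margProj G Dc.toC (pieceZero_cur Dc) (pieceLocal_cur Dc) (csrcScale_cur hD)
    (pieceBoundOnG_cur hD κ) (kp_nonneg hD) (fun k j => pow_nonneg (hℓg k j) 5) hL hO1 hcQ hAdmAn hA16 ρ U₀ explZ h0 hAdm hres
    hrA hr0 hrs hA hcr haA hAan hAmul hcoef hnorm hS hfac hclip0 hCup hqT0 hTcup hreprV hclipb hqTb hK hdec hpin hρ hexplZ hbase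
    hNsucc hNnn hbox hB hlipb hω hpos

/-! ## §3 The ray sub-case recovered -/

section Ray

omit [DecidableEq δ] in
/-- At the ray reading `D.toCur` of a ray datum the species constant is the ray species' `KpOf` (definitional; with the owner's
`RemData.toCur_toC` every letter of the §1/§2 faces at `Dc := D.toCur` is LITERALLY p213217's). [folklore] -/
theorem toCur_Kp (D : RemData C₀ E ι α β γ δ) (cdir : ℝ) : D.toCur.Kp cdir = KpOf D cdir := rfl

/-- THE RAY SUB-CASE RECOVERED (consistency, kernel): p213217's S5 input at the ray datum — the owner's `pieceBoundOnG_rem` — is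
the curve bound `pieceBoundOnG_cur` at `Dc := D.toCur` (under the displayed strict positivity of the direction bounds), with the
same constant; so §1/§2 at `Dc := D.toCur` are p213217 §3/§4 with `hD ↦ hD.toCur hpos` (the curve faces GENERALISE the landed ray
faces). [folklore] -/
example {D : RemData C₀ E ι α β γ δ} {ℓ : ℕ → ℕ → ℝ} {cdir d0 : ℝ} (hD : D.Admissible ℓ cdir d0)
    (hpos : ∀ k s y a b x, 0 < D.dirB k s y a b x) (κ : ℝ) :
    PieceBoundOnG (analyticClass D.R) D.toC κ D.κ₁ d0 (KpOf D cdir) (fun k j => ℓ k j ^ 5) := by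
  rw [← D.toCur_toC, ← toCur_Kp]
  exact pieceBoundOnG_cur (hD.toCur hpos) κ

end Ray

end Summit.QuantumFields.BalabanUV.T4Continuum.NE9CurveSpeciesMargProj

end
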